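import Summits.AtomisticToContinuum.FouriersLaw.Theorems.PhononMeanFreePathIncoherentBoundedCarreDuChamp
import Summits.AtomisticToContinuum.FouriersLaw.Theorems.BondHeatUncertaintySubdiffusiveBondHeatKernelGibbsF
import Summits.AtomisticToContinuum.FouriersLaw.Theorems.OddSectorIrreversibilityResponseDensitySmoothForecast
import Mathlib.MeasureTheory.Integral.IntervalIntegral.Basic

/-!
# `PhononMeanFreePath.IncoherentBounded` — the dissipation inequality of the equilibrium semigroup

Helper file for item `stmt-AtomisticToContinuum-11815` (support `IncoherentBounded`, route `PhononMeanFreePath`,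
sub-problem `FouriersLaw`). For the pinned anharmonic chain at equal bath temperatures `T_L = T_R = T > 0`
(`ω₂, β, γ > 0`, `lam ≥ 0`, `N ≥ 1`) with Gibbs measure `μ_T` (invariant for the constructed kernels `K_t`,
`pinnedChain_integral_transitionKernel_gibbsMeasure`) and a continuous compactly supported observable `F`, the
forecasts `u_s = K_s F` satisfy the **dissipation (energy) inequality**

  `∫_{s>0} ∫ 2Γ(u_s) dμ_T ds ≤ ∫ F² dμ_T`,   `2Γ(f) = 2γ ∑_i w_i (∂_{p_i} f)²`, `w_i = [i=0]T + [i=N-1]T`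

(`dissipation_lintegral_le`, lower Lebesgue integrals; `dissipation_lintegral_le'` discharges the smoothness of
the forecasts by hypoellipticity, `pinnedChain_contDiffOn_forecast`). This is the integrated Bakry–Émery identity
`d/ds ‖u_s‖² = -2∫Γ(u_s) dμ_T`, proved WITHOUT identifying the `L²` generator: `g(s) = ‖u_s‖²` is bounded by `‖F‖²`
(Jensen + invariance), `g(s) - g(s+h) = ∫ Var_{K_h(x,·)}(u_s) dμ_T(x)` (Chapman–Kolmogorov + invariance), the
one-step variance expansion `Var_{K_h(x,·)}(u) = 2hΓ(u)(x) + o(h)` (`kernel_variance_step_of_bounded`, file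
`…CarreDuChamp`), Fatou in `x`, a telescoping bound in `s`, and Fatou in `s`.

It is the only `N`-uniform a-priori estimate available on the constructed dynamics, and it yields the `N`-uniform
coherent (Landauer-type) bound `∫₀^∞ r_N² ≤ T²/(2γ)` on the momentum cross-correlation of the item
(file `…IncoherentBoundedCoherentLandauer`). No definitions.
-/

noncomputable section

open MeasureTheory ProbabilityTheory Filter Topology Set
open scoped NNReal ENNReal ContDiff
open Literature.MathematicalPhysics.KineticTheory.HeatConduction
open Literature.MathematicalPhysics.KineticTheory Literature.Probability.Process OscillatorChain

namespace Summit.AtomisticToContinuum.FouriersLaw.Theorems.IncoherentBounded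

variable {N : ℕ}

/-! ## 4. The dissipation inequality of the equilibrium semigroup -/

section Dissipation

open Summit.AtomisticToContinuum.FouriersLaw.Theorems.SubdiffusiveBondHeat

variable {ω₂ lam β γ : ℝ} (hω : 0 < ω₂) (hl : 0 ≤ lam) (hβ : 0 < β) (hγ : 0 < γ)
  (hN : 0 < N) {T : ℝ} (hT : 0 < T)
include hω hl hβ hγ hN hT

omit hω hl hβ hγ hN hT in
/-- Variance is nonnegative: `(∫ u dκ)² ≤ ∫ u² dκ` for a probability measure `κ`. [folklore] -/
theorem sq_integral_le_integral_sq {κ : Measure (PhaseSpace N)} [IsProbabilityMeasure κ]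
    {u : PhaseSpace N → ℝ} (hu : Integrable u κ) (hu2 : Integrable (fun z => u z ^ 2) κ) :
    (∫ z, u z ∂κ) ^ 2 ≤ ∫ z, u z ^ 2 ∂κ := by
  set c := ∫ z, u z ∂κ with hc
  have h0 : 0 ≤ ∫ z, (u z - c) ^ 2 ∂κ := integral_nonneg fun z => sq_nonneg _
  have i1 : Integrable (fun z => u z ^ 2 - 2 * c * u z) κ := hu2.sub (hu.const_mul _)
  have h1 : ∫ z, (u z - c) ^ 2 ∂κ = (∫ z, u z ^ 2 ∂κ) - 2 * c * (∫ z, u z ∂κ) + c ^ 2 := by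
    have : (fun z => (u z - c) ^ 2) = fun z => (u z ^ 2 - 2 * c * u z) + c ^ 2 := by funext z; ring
    rw [this, integral_add i1 (integrable_const _), integral_sub hu2 (hu.const_mul _),
      integral_const_mul, integral_const, probReal_univ, one_smul]
  rw [← hc] at h1
  nlinarith [h0, h1]

omit hω hl hβ hγ hN hT in
/-- A bounded measurable function is integrable for a probability measure, and its integral obeys the same
bound. [folklore] -/
theorem integrable_and_abs_integral_le {ν : Measure (PhaseSpace N)} [IsProbabilityMeasure ν]
    {v : PhaseSpace N → ℝ} (hv : Measurable v) {C : ℝ} (hC : ∀ z, |v z| ≤ C) :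
    Integrable v ν ∧ |∫ z, v z ∂ν| ≤ C := by
  have hi : Integrable v ν := (integrable_const C).mono' hv.aestronglyMeasurable
    (Eventually.of_forall fun z => by rw [Real.norm_eq_abs]; exact hC z)
  refine ⟨hi, ?_⟩
  have h1 : |∫ z, v z ∂ν| ≤ ∫ z, |v z| ∂ν := abs_integral_le_integral_abs
  have h2 : ∫ z, |v z| ∂ν ≤ ∫ z, C ∂ν := integral_mono hi.abs (integrable_const C) fun z => hC z
  have h3 : ∫ z, C ∂ν = C := by rw [integral_const, probReal_univ, one_smul]
  linarith

omit hβ hγ hN hT in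
/-- Joint (strong) measurability of the forecast `(s, x) ↦ K_{s⁺} F(x)` of a continuous observable `F`
(joint measurability of the constructed kernels, `pinnedChain_measurable_transitionKernel`). [folklore] -/
theorem stronglyMeasurable_forecast (hβ' : 0 ≤ β) (hγ' : 0 ≤ γ) (T_L T_R : ℝ) {F : PhaseSpace N → ℝ}
    (hFc : Continuous F) :
    StronglyMeasurable fun q : ℝ × PhaseSpace N =>
      ∫ y, F y ∂((pinnedChain ω₂ lam β γ).transitionKernel N T_L T_R q.1.toNNReal q.2) := by
  set P := pinnedChain ω₂ lam β γ with hP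
  let κ₂ : Kernel (ℝ≥0 × PhaseSpace N) (PhaseSpace N) :=
    { toFun := fun p => P.transitionKernel N T_L T_R p.1 p.2
      measurable' := pinnedChain_measurable_transitionKernel hω hl hβ' hγ' N T_L T_R }
  have hG : StronglyMeasurable fun p : ℝ≥0 × PhaseSpace N => ∫ y, F y ∂(κ₂ p) :=
    hFc.stronglyMeasurable.integral_kernel (κ := κ₂)
  have h2 : StronglyMeasurable fun q : ℝ × PhaseSpace N => ∫ y, F y ∂(κ₂ (q.1.toNNReal, q.2)) :=
    hG.comp_measurable ((measurable_real_toNNReal.comp measurable_fst).prodMk measurable_snd)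
  exact h2

omit hβ hγ hN hT in
/-- Chapman–Kolmogorov for forecasts: `K_{(s+h)⁺} F (x) = ∫ (K_{s⁺} F) dK_{h⁺}(x, ·)` (`s, h ≥ 0`) for bounded
continuous `F` (`pinnedChain_transitionKernel_add`). [folklore] -/
theorem forecast_add (hβ' : 0 ≤ β) (hγ' : 0 ≤ γ) (T_L T_R : ℝ) {F : PhaseSpace N → ℝ} (hFc : Continuous F)
    {M : ℝ} (hM : ∀ z, |F z| ≤ M) {s h : ℝ} (hs : 0 ≤ s) (hh : 0 ≤ h) (x : PhaseSpace N) :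
    ∫ y, F y ∂((pinnedChain ω₂ lam β γ).transitionKernel N T_L T_R (s + h).toNNReal x) =
      ∫ z, (∫ y, F y ∂((pinnedChain ω₂ lam β γ).transitionKernel N T_L T_R s.toNNReal z))
        ∂((pinnedChain ω₂ lam β γ).transitionKernel N T_L T_R h.toNNReal x) := by
  set P := pinnedChain ω₂ lam β γ
  haveI := fun t => pinnedChain_isMarkovKernel_transitionKernel hω hl hβ' hγ' N T_L T_R t
  rw [Real.toNNReal_add hs hh, add_comm, pinnedChain_transitionKernel_add hω hl hβ' hγ' N T_L T_R]
  have hi : Integrable F ((P.transitionKernel N T_L T_R s.toNNReal ∘ₖ P.transitionKernel N T_L T_R h.toNNReal) x) :=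
    (integrable_const M).mono' hFc.aestronglyMeasurable (Eventually.of_forall fun z => by
      rw [Real.norm_eq_abs]; exact hM z)
  exact Kernel.integral_comp hi

/-- **The dissipation inequality of the equilibrium semigroup of the pinned chain.** Let `T_L = T_R = T > 0`,
`μ_T` the Gibbs measure (invariant for the constructed kernels `K_t`), `F` continuous with compact support, and
assume the forecasts `u_s = K_s F` are `C²` in the starting point for `s > 0` (which holds by hypoellipticity,
`pinnedChain_contDiffOn_forecast`). Then, with the carré du champ `2Γ(f) = 2γ ∑_i w_i (∂_{p_i} f)²`,

  `∫_{s>0} ∫ 2Γ(u_s) dμ_T ds ≤ ∫ F² dμ_T`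

(lower Lebesgue integrals). Proof: `g(s) = ‖u_s‖²_{L²(μ_T)}` is bounded by `‖F‖²` (Jensen + invariance) and
`g(s) - g(s+h) = ∫ Var_{K_h(x,·)}(u_s) dμ_T(x) ≥ 0` (Chapman–Kolmogorov + invariance); the pointwise expansion
`Var_{K_h(x,·)}(u_s) = 2hΓ(u_s)(x) + o(h)` (`kernel_variance_step_of_bounded`) and Fatou's lemma in `x` give
`∫ 2Γ(u_s) dμ_T ≤ liminf_h (g(s) - g(s+h))/h`; Fatou in `s` and
`∫_0^S (g(s) - g(s+h)) ds = ∫_0^h g - ∫_S^{S+h} g ≤ h ‖F‖²` conclude. This is the integrated form of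
`d/ds ‖u_s‖² = -2 ∫ Γ(u_s) dμ_T` (Bakry–Émery), obtained without identifying the `L²` generator. [folklore] -/
theorem dissipation_lintegral_le {F : PhaseSpace N → ℝ} (hFc : Continuous F) (hFs : HasCompactSupport F)
    (hsmooth : ∀ s : ℝ, 0 < s → ContDiff ℝ 2 fun x : PhaseSpace N =>
      ∫ y, F y ∂((pinnedChain ω₂ lam β γ).transitionKernel N T T s.toNNReal x)) :
    ∫⁻ s in Ioi (0 : ℝ), ∫⁻ x, ENNReal.ofReal (2 * (γ * ∑ i : Fin N,
        ((if i.val = 0 then T else 0) + (if i.val = N - 1 then T else 0)) *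
          partialP i (fun z => ∫ y, F y ∂((pinnedChain ω₂ lam β γ).transitionKernel N T T s.toNNReal z)) x ^ 2))
        ∂((pinnedChain ω₂ lam β γ).gibbsMeasure N T) ≤
      ENNReal.ofReal (∫ x, F x ^ 2 ∂((pinnedChain ω₂ lam β γ).gibbsMeasure N T)) := by
  set P := pinnedChain ω₂ lam β γ with hP
  set μ := P.gibbsMeasure N T with hμ
  haveI : IsProbabilityMeasure μ := pinnedChain_isProbabilityMeasure_gibbsMeasure hω hl hβ.le γ N hT
  haveI hMK : ∀ t, IsMarkovKernel (P.transitionKernel N T T t) := fun t =>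
    pinnedChain_isMarkovKernel_transitionKernel hω hl hβ.le hγ.le N T T t
  -- the forecast `U s x = K_{s⁺} F (x)` and its bound
  set U : ℝ → PhaseSpace N → ℝ := fun s x => ∫ y, F y ∂(P.transitionKernel N T T s.toNNReal x) with hU
  obtain ⟨M, hM⟩ : ∃ M, ∀ x, ‖F x‖ ≤ M := hFc.bounded_above_of_compact_support hFs
  have hM' : ∀ z, |F z| ≤ M := fun z => by rw [← Real.norm_eq_abs]; exact hM z
  have hM0 : 0 ≤ M := (norm_nonneg _).trans (hM 0)
  have hUb : ∀ s x, |U s x| ≤ M := fun s x =>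
    (integrable_and_abs_integral_le (ν := P.transitionKernel N T T s.toNNReal x) hFc.measurable hM').2
  have hUsm : StronglyMeasurable (Function.uncurry U) :=
    stronglyMeasurable_forecast hω hl hβ.le hγ.le T T hFc
  have hUm : ∀ s, Measurable (U s) := fun s => (hUsm.comp_measurable measurable_prodMk_left).measurable
  have hU2b : ∀ s z, |U s z ^ 2| ≤ M ^ 2 := fun s z => by
    rw [abs_pow]; exact pow_le_pow_left₀ (abs_nonneg _) (hUb s z) 2
  -- the carré du champ density along the forecast
  set Γ2 : ℝ → PhaseSpace N → ℝ := fun s x => 2 * (γ * ∑ i : Fin N,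
      ((if i.val = 0 then T else 0) + (if i.val = N - 1 then T else 0)) * partialP i (U s) x ^ 2) with hΓ2
  show ∫⁻ s in Ioi (0 : ℝ), ∫⁻ x, ENNReal.ofReal (Γ2 s x) ∂μ ≤ ENNReal.ofReal (∫ x, F x ^ 2 ∂μ)
  -- `g(s) = ‖u_s‖²` and its bound (Jensen + invariance: `pinnedChain_integral_sq_act_le`)
  set g : ℝ → ℝ := fun s => ∫ x, U s x ^ 2 ∂μ with hg
  set Cg : ℝ := ∫ x, F x ^ 2 ∂μ with hCg
  have hϑ0 : (0 : ℝ) < 1 / (4 * T) := by positivity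
  have h2ϑ : 2 * (1 / (4 * T)) < 1 / T := by
    rw [show 2 * (1 / (4 * T)) = 1 / (2 * T) by field_simp; ring, div_lt_div_iff₀ (by positivity) hT]; nlinarith
  have hFexp : ∀ y, |F y| ≤ M * Real.exp (1 / (4 * T) * P.hamiltonian N y) := fun y =>
    (hM' y).trans (le_mul_of_one_le_right hM0 (Real.one_le_exp (mul_nonneg hϑ0.le
      (pinnedChain_hamiltonian_nonneg hω.le hl hβ.le γ N y))))
  have hgle : ∀ s, g s ≤ Cg := fun s =>
    (pinnedChain_integral_sq_act_le hω hl hβ hγ hN hT hϑ0 h2ϑ hFc hFexp s.toNNReal).2.2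
  have hg0 : ∀ s, 0 ≤ g s := fun s => integral_nonneg fun x => sq_nonneg _
  have hCg0 : 0 ≤ Cg := (hg0 0).trans (hgle 0)
  have hgm : Measurable g := by
    have h1 : StronglyMeasurable fun q : ℝ × PhaseSpace N => Function.uncurry U q ^ 2 :=
      (hUsm.measurable.pow_const 2).stronglyMeasurable
    exact (h1.integral_prod_right' (ν := μ)).measurable
  -- the conditional variance `V h s x = ∫ u_s² dK_h(x,·) - (∫ u_s dK_h(x,·))²`
  set V : ℝ≥0 → ℝ → PhaseSpace N → ℝ := fun h s x =>
    (∫ z, U s z ^ 2 ∂(P.transitionKernel N T T h x)) - (∫ z, U s z ∂(P.transitionKernel N T T h x)) ^ 2 with hV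
  have hA : ∀ (h : ℝ≥0) s, Measurable (fun x => ∫ z, U s z ^ 2 ∂(P.transitionKernel N T T h x)) ∧
      ∀ x, |∫ z, U s z ^ 2 ∂(P.transitionKernel N T T h x)| ≤ M ^ 2 := fun h s =>
    ⟨(((hUm s).pow_const 2).stronglyMeasurable.integral_kernel (κ := P.transitionKernel N T T h)).measurable,
      fun x => (integrable_and_abs_integral_le ((hUm s).pow_const 2) (hU2b s)).2⟩
  have hB : ∀ (h : ℝ≥0) s, Measurable (fun x => ∫ z, U s z ∂(P.transitionKernel N T T h x)) ∧
      ∀ x, |∫ z, U s z ∂(P.transitionKernel N T T h x)| ≤ M := fun h s =>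
    ⟨((hUm s).stronglyMeasurable.integral_kernel (κ := P.transitionKernel N T T h)).measurable,
      fun x => (integrable_and_abs_integral_le (hUm s) (hUb s)).2⟩
  have hV0 : ∀ h s x, 0 ≤ V h s x := fun h s x =>
    sub_nonneg.2 (sq_integral_le_integral_sq (integrable_and_abs_integral_le (hUm s) (hUb s)).1
      (integrable_and_abs_integral_le ((hUm s).pow_const 2) (hU2b s)).1)
  have hVm : ∀ h s, Measurable (V h s) := fun h s => (hA h s).1.sub ((hB h s).1.pow_const 2)
  have hVb : ∀ h s x, |V h s x| ≤ M ^ 2 := fun h s x => by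
    rw [abs_of_nonneg (hV0 h s x)]
    have h1 := (le_abs_self _).trans ((hA h s).2 x)
    have h2 := sq_nonneg (∫ z, U s z ∂(P.transitionKernel N T T h x))
    show (∫ z, U s z ^ 2 ∂(P.transitionKernel N T T h x)) - (∫ z, U s z ∂(P.transitionKernel N T T h x)) ^ 2 ≤ M ^ 2
    linarith
  -- `g s - g (s+h) = ∫ V h s dμ` (Chapman–Kolmogorov + invariance of μ)
  have hgV : ∀ (h : ℝ≥0) (s : ℝ), 0 ≤ s → g s - g (s + h) = ∫ x, V h s x ∂μ := by
    intro h s hs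
    have hcomp : ∀ x, U (s + h) x = ∫ z, U s z ∂(P.transitionKernel N T T h x) := fun x => by
      have e := forecast_add hω hl hβ.le hγ.le T T hFc hM' hs (NNReal.coe_nonneg h) x
      rw [Real.toNNReal_coe] at e
      exact e
    have hinv : ∫ x, (∫ z, U s z ^ 2 ∂(P.transitionKernel N T T h x)) ∂μ = ∫ x, U s x ^ 2 ∂μ :=
      pinnedChain_integral_transitionKernel_gibbsMeasure hω hl hβ.le hγ.le hN hT h
        (integrable_and_abs_integral_le (ν := μ) ((hUm s).pow_const 2) (hU2b s)).1
    have hAi : Integrable (fun x => ∫ z, U s z ^ 2 ∂(P.transitionKernel N T T h x)) μ :=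
      (integrable_and_abs_integral_le (hA h s).1 (hA h s).2).1
    have hBi : Integrable (fun x => (∫ z, U s z ∂(P.transitionKernel N T T h x)) ^ 2) μ :=
      (integrable_and_abs_integral_le ((hB h s).1.pow_const 2) (C := M ^ 2) fun x => by
        rw [abs_pow]; exact pow_le_pow_left₀ (abs_nonneg _) ((hB h s).2 x) 2).1
    calc g s - g (s + h) = (∫ x, U s x ^ 2 ∂μ) - ∫ x, U (s + h) x ^ 2 ∂μ := rfl
      _ = (∫ x, (∫ z, U s z ^ 2 ∂(P.transitionKernel N T T h x)) ∂μ) -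
            ∫ x, (∫ z, U s z ∂(P.transitionKernel N T T h x)) ^ 2 ∂μ := by
          rw [hinv]; simp only [hcomp]
      _ = ∫ x, V h s x ∂μ := by rw [← integral_sub hAi hBi]
  -- the sequence of steps `h_k = 1/(k+1)`
  set hk : ℕ → ℝ≥0 := fun k => ((k : ℝ≥0) + 1)⁻¹ with hhk
  have hk_pos : ∀ k, 0 < (hk k : ℝ) := fun k => by
    rw [hhk]; dsimp only; rw [NNReal.coe_inv]; positivity
  have hk_tend : Tendsto (fun k => (hk k : ℝ)) atTop (𝓝 0) := by
    have : (fun k : ℕ => (hk k : ℝ)) = fun k : ℕ => 1 / ((k : ℝ) + 1) := by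
      funext k; rw [hhk]; dsimp only; rw [NNReal.coe_inv]; push_cast; ring
    rw [this]; exact tendsto_one_div_add_atTop_nhds_zero_nat
  -- pointwise limit of `V/h` (the one-step variance expansion at a point)
  have hlim : ∀ s, 0 < s → ∀ x, Tendsto (fun k => V (hk k) s x / (hk k : ℝ)) atTop (𝓝 (Γ2 s x)) := by
    intro s hs x
    rw [Metric.tendsto_atTop]
    intro ε hε
    obtain ⟨h₀, hh₀, H⟩ := kernel_variance_step_of_bounded hω hl hβ.le hγ.le hN hT.le hT.le (hsmooth s hs)
      (hUb s) x (half_pos hε)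
    obtain ⟨K, hK⟩ := eventually_atTop.1 (hk_tend.eventually (Iic_mem_nhds hh₀))
    refine ⟨K, fun k hkK => ?_⟩
    have e : |V (hk k) s x - (hk k : ℝ) * Γ2 s x| ≤ ε / 2 * (hk k : ℝ) :=
      H (hk k) (hk_pos k) (mem_Iic.1 (hK k hkK))
    rw [Real.dist_eq]
    have hne : (hk k : ℝ) ≠ 0 := (hk_pos k).ne'
    have : V (hk k) s x / (hk k : ℝ) - Γ2 s x = (V (hk k) s x - (hk k : ℝ) * Γ2 s x) / (hk k : ℝ) := by
      rw [eq_div_iff hne, sub_mul, div_mul_cancel₀ _ hne, mul_comm (hk k : ℝ) (Γ2 s x)]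
    rw [this, abs_div, abs_of_pos (hk_pos k), div_lt_iff₀ (hk_pos k)]
    calc |V (hk k) s x - (hk k : ℝ) * Γ2 s x| ≤ ε / 2 * (hk k : ℝ) := e
      _ < ε * (hk k : ℝ) := by nlinarith [hk_pos k]
  -- Fatou in `x`
  have hFx : ∀ s, 0 < s →
      ∫⁻ x, ENNReal.ofReal (Γ2 s x) ∂μ ≤ liminf (fun k => ENNReal.ofReal ((g s - g (s + hk k)) / hk k)) atTop := by
    intro s hs
    have h1 : ∀ x, liminf (fun k => ENNReal.ofReal (V (hk k) s x / hk k)) atTop = ENNReal.ofReal (Γ2 s x) :=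
      fun x => (ENNReal.tendsto_ofReal (hlim s hs x)).liminf_eq
    have hVint : ∀ k, Integrable (fun x => V (hk k) s x / hk k) μ := fun k =>
      ((integrable_and_abs_integral_le (hVm _ s) (hVb _ s)).1).div_const _
    calc ∫⁻ x, ENNReal.ofReal (Γ2 s x) ∂μ
        = ∫⁻ x, liminf (fun k => ENNReal.ofReal (V (hk k) s x / hk k)) atTop ∂μ :=
          lintegral_congr fun x => (h1 x).symm
      _ ≤ liminf (fun k => ∫⁻ x, ENNReal.ofReal (V (hk k) s x / hk k) ∂μ) atTop :=
          lintegral_liminf_le fun k => ((hVm _ s).div_const _).ennreal_ofReal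
      _ = liminf (fun k => ENNReal.ofReal ((g s - g (s + hk k)) / hk k)) atTop := by
          refine Filter.liminf_congr (Eventually.of_forall fun k => ?_)
          rw [← ofReal_integral_eq_lintegral_ofReal (hVint k)
            (Eventually.of_forall fun x => div_nonneg (hV0 _ _ _) (hk_pos k).le), integral_div, hgV (hk k) s hs.le]
  -- the telescoping bound `∫_{s>0} (g s - g (s+h))/h ds ≤ Cg`
  have hgii : ∀ a b : ℝ, IntervalIntegrable g volume a b := fun a b =>
    (intervalIntegrable_const (c := Cg)).mono_fun' hgm.aestronglyMeasurable
      (Eventually.of_forall fun s => by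
        show ‖g s‖ ≤ Cg
        rw [Real.norm_eq_abs, abs_of_nonneg (hg0 s)]; exact hgle s)
  have htel : ∀ {h : ℝ}, 0 < h → ∀ {S : ℝ}, 0 ≤ S →
      ∫ s in (0 : ℝ)..S, (g s - g (s + h)) = (∫ s in (0 : ℝ)..h, g s) - ∫ s in S..(S + h), g s := by
    intro h hh S hS
    rw [intervalIntegral.integral_sub (hgii 0 S) ((IntervalIntegrable.comp_add_right_iff (f := g) (a := 0) (b := S)).mpr (hgii (0 + h) (S + h))),
      intervalIntegral.integral_comp_add_right g h, zero_add]
    have e1 := intervalIntegral.integral_add_adjacent_intervals (hgii 0 h) (hgii h (S + h))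
    have e2 := intervalIntegral.integral_add_adjacent_intervals (hgii 0 S) (hgii S (S + h))
    linarith
  have hGint : ∀ {h : ℝ}, 0 < h → ∫⁻ s in Ioi (0 : ℝ), ENNReal.ofReal ((g s - g (s + h)) / h) ≤ ENNReal.ofReal Cg := by
    intro h hh
    -- on bounded windows
    have hwin : ∀ n : ℕ, ∫⁻ s in Ioc (0 : ℝ) n, ENNReal.ofReal ((g s - g (s + h)) / h) ≤ ENNReal.ofReal Cg := by
      intro n
      have hn : (0 : ℝ) ≤ n := n.cast_nonneg
      have hdm : Measurable fun s => (g s - g (s + h)) / h :=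
        (hgm.sub (hgm.comp (measurable_id.add_const h))).div_const h
      have hdi : IntegrableOn (fun s => (g s - g (s + h)) / h) (Ioc (0 : ℝ) n) := by
        refine (integrableOn_const (C := (2 * Cg) / h) (hs := measure_Ioc_lt_top.ne)).mono' hdm.aestronglyMeasurable
          (Eventually.of_forall fun s => ?_)
        show ‖(g s - g (s + h)) / h‖ ≤ 2 * Cg / h
        rw [Real.norm_eq_abs, abs_div, abs_of_pos hh]
        gcongr
        have := hgle s; have := hg0 s; have := hgle (s + h); have := hg0 (s + h)
        rw [abs_le]; constructor <;> linarith
      have hnn : 0 ≤ᵐ[volume.restrict (Ioc (0 : ℝ) n)] fun s => (g s - g (s + h)) / h := by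
        rw [EventuallyLE, ae_restrict_iff' measurableSet_Ioc]
        refine Eventually.of_forall fun s hs => div_nonneg ?_ hh.le
        have e : g s - g (s + h) = ∫ x, V ⟨h, hh.le⟩ s x ∂μ := hgV ⟨h, hh.le⟩ s hs.1.le
        show 0 ≤ g s - g (s + h)
        rw [e]; exact integral_nonneg fun x => hV0 _ _ _
      rw [← ofReal_integral_eq_lintegral_ofReal hdi hnn]
      refine ENNReal.ofReal_le_ofReal ?_
      rw [← intervalIntegral.integral_of_le hn, intervalIntegral.integral_div, htel hh hn]
      have h1 : ∫ s in (0 : ℝ)..h, g s ≤ h * Cg := by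
        have := intervalIntegral.integral_mono_on hh.le (hgii 0 h) intervalIntegrable_const fun s _ => hgle s
        simpa using this
      have h2 : 0 ≤ ∫ s in (n : ℝ)..(n + h), g s :=
        intervalIntegral.integral_nonneg (by linarith) fun s _ => hg0 s
      rw [div_le_iff₀ hh]
      linarith
    -- monotone convergence over the windows
    have hU : Ioi (0 : ℝ) = ⋃ n : ℕ, Ioc (0 : ℝ) n := by
      ext s
      simp only [mem_Ioi, mem_iUnion, mem_Ioc]
      constructor
      · intro hs; obtain ⟨n, hn⟩ := exists_nat_ge s; exact ⟨n, hs, hn⟩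
      · rintro ⟨n, hs, -⟩; exact hs
    have hdir : Directed (· ⊆ ·) fun n : ℕ => Ioc (0 : ℝ) n := fun a b =>
      ⟨max a b, Ioc_subset_Ioc_right (by exact_mod_cast le_max_left a b),
        Ioc_subset_Ioc_right (by exact_mod_cast le_max_right a b)⟩
    rw [hU, setLIntegral_iUnion_of_directed _ hdir]
    exact iSup_le hwin
  -- Fatou in `s` and conclusion
  set G : ℕ → ℝ → ℝ≥0∞ := fun k s => ENNReal.ofReal ((g s - g (s + hk k)) / hk k) with hG
  have hGm : ∀ k, Measurable (G k) := fun k =>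
    ((hgm.sub (hgm.comp (measurable_id.add_const _))).div_const _).ennreal_ofReal
  calc ∫⁻ s in Ioi (0 : ℝ), ∫⁻ x, ENNReal.ofReal (Γ2 s x) ∂μ
      ≤ ∫⁻ s in Ioi (0 : ℝ), liminf (fun k => G k s) atTop :=
        setLIntegral_mono' measurableSet_Ioi fun s hs => hFx s hs
    _ ≤ liminf (fun k => ∫⁻ s in Ioi (0 : ℝ), G k s) atTop := lintegral_liminf_le hGm
    _ ≤ ENNReal.ofReal Cg :=
        liminf_le_of_frequently_le' (Frequently.of_forall fun k => hGint (hk_pos k))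

end Dissipation

/-! ## 5. Discharging the smoothness of the forecasts (hypoellipticity) -/

section Smooth

open Summit.AtomisticToContinuum.FouriersLaw.Theorems.SubdiffusiveBondHeat

variable {ω₂ lam β γ : ℝ} (hω : 0 < ω₂) (hl : 0 ≤ lam) (hβ : 0 < β) (hγ : 0 < γ)
  (hN : 0 < N) {T : ℝ} (hT : 0 < T)
include hω hl hβ hγ hN hT

omit hβ hT in
/-- Smoothness of the forecasts in the starting point: for `F ∈ C_c` and `s > 0`, `x ↦ K_s F(x)` is `C²`
(slice of `pinnedChain_contDiffOn_forecast`, Hörmander hypoellipticity of `∂_s - L`). -/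
theorem contDiff_forecast (hβ' : 0 ≤ β) {T_L T_R : ℝ} (hL : 0 < T_L) (hR : 0 ≤ T_R) {F : PhaseSpace N → ℝ}
    (hFc : Continuous F) (hFs : HasCompactSupport F) {s : ℝ} (hs : 0 < s) :
    ContDiff ℝ 2 fun x : PhaseSpace N =>
      ∫ y, F y ∂((pinnedChain ω₂ lam β γ).transitionKernel N T_L T_R s.toNNReal x) := by
  have h := pinnedChain_contDiffOn_forecast hω hl hβ' hγ hN hL hR hFc hFs
  have h2 := h.comp_contDiff (contDiff_const.prodMk contDiff_id) fun z => ⟨hs, Set.mem_univ _⟩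
  exact h2.of_le (by norm_cast)

/-- **The dissipation inequality, unconditional form**: for `F ∈ C_c(Ω)` and `T > 0`,
`∫_{s>0} ∫ 2γ ∑_i w_i (∂_{p_i} K_s F)² dμ_T ds ≤ ∫ F² dμ_T` (`dissipation_lintegral_le` with the smoothness of
the forecasts supplied by `contDiff_forecast`). -/
theorem dissipation_lintegral_le' {F : PhaseSpace N → ℝ} (hFc : Continuous F) (hFs : HasCompactSupport F) :
    ∫⁻ s in Ioi (0 : ℝ), ∫⁻ x, ENNReal.ofReal (2 * (γ * ∑ i : Fin N,
        ((if i.val = 0 then T else 0) + (if i.val = N - 1 then T else 0)) *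
          partialP i (fun z => ∫ y, F y ∂((pinnedChain ω₂ lam β γ).transitionKernel N T T s.toNNReal z)) x ^ 2))
        ∂((pinnedChain ω₂ lam β γ).gibbsMeasure N T) ≤
      ENNReal.ofReal (∫ x, F x ^ 2 ∂((pinnedChain ω₂ lam β γ).gibbsMeasure N T)) :=
  dissipation_lintegral_le hω hl hβ hγ hN hT hFc hFs fun _ hs =>
    contDiff_forecast hω hl hγ hN hβ.le hT hT.le hFc hFs hs

end Smooth

end Summit.AtomisticToContinuum.FouriersLaw.Theorems.IncoherentBounded
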